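import Literature.Geometry.Lorentzian.KerrSchildCoord
import Summits.FinalStateConjecture.FinalStateConjecture.Theorems.BartnikGapSettlingGapExhaustionInjectiveMfderivOfClose
import HarnessLib

/-!
# `KerrBilinCoerciveExterior`: uniform coercivity of the Kerr–Schild forms on the exterior `{r ≥ r_lo}`
(crux `GapExhaustion`, stmt-FinalStateConjecture-10808, line photon-shell-pseudoconvexity;
stub (W3-A) `stub_kerrBilin_coercive_exterior`, node glue)

The line's node hypothesis `FarSilentNearKerr` controls the pulled-back metric of an eternal star
chart on the whole star domain by `‖Ψ^* g − g_{M,a}‖ ≤ δM/r`, but has no immersion clause; the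
landed glue `stub_injective_mfderiv_of_close` ("closeness to a coercive form ⇒ injective
differential") needs a coercivity constant of `g_{M,a}` that is UNIFORM on the non-compact
exterior `{r ≥ r_lo}` (all times and all large radii). This file supplies it:

* **far** (`kerrCoercive_far`): for `M ≥ 0` and `r ≥ 4M`, `r > 0`, one has `0 ≤ 2H ≤ 1/2`
  (`H = M r³/(r⁴ + a²z²) ≤ M/r`), and testing the covector `g_{M,a}(z)(v, ·)` on the time-reflected
  vector `w = v − 2v⁰ ∂₀` (`‖w‖ = ‖v‖`, `η(v, w) = ‖v‖²`, `ℓ(w) = ℓ(v) − 2v⁰` as `ℓ₀ = 1`) gives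
  `g(v, w) = ‖v‖² + 2H ((ℓ(v) − v⁰)² − (v⁰)²) ≥ (1 − 2H)‖v‖² ≥ ‖v‖²/2`, whence
  `‖g_{M,a}(z) v‖ ≥ ‖v‖/2`;
* **band**: on `r_lo ≤ r ≤ R₀ := max r_lo (4M + 1)` the landed band coercivity
  `stub_injective_mfderiv_of_close.2` (compactness of the time slice, nondegeneracy, stationarity);

and `β := min (1/2) β_band`.
-/

noncomputable section

-- instance search through the nested operator types `E4 →L[ℝ] E4 →L[ℝ] ℝ`
set_option maxSynthPendingDepth 3

-- D-0017: single-problem summit, `Summit.<S>.<S>.…` by design (cf. lakefile `weak.linter.dupNamespace`).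
set_option linter.dupNamespace false

namespace Summit.FinalStateConjecture.FinalStateConjecture.Theorems

open Set Literature.Geometry.Lorentzian
open scoped Manifold ContDiff Topology

/-- `2H ≤ 1/2` for `M ≥ 0`, `r > 0`, `r ≥ 4M`: `H = M r³/(r⁴ + a² z²) ≤ M r³/r⁴ = M/r ≤ 1/4`
(Visser arXiv:0706.0622, (33); cf. `Kerr.scalarH_le_div`). [folklore] -/
theorem kerrCoercive_two_mul_scalarH_le_half {M : ℝ} (hM : 0 ≤ M) (a : ℝ) {z : E4}
    (hr : 0 < Kerr.radius a z) (h4 : 4 * M ≤ Kerr.radius a z) :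
    2 * Kerr.scalarH M a z ≤ 1 / 2 := by
  unfold Kerr.scalarH
  have hden : 0 < Kerr.radius a z ^ 4 + a ^ 2 * z 3 ^ 2 := by positivity
  have key : M * Kerr.radius a z ^ 3 / (Kerr.radius a z ^ 4 + a ^ 2 * z 3 ^ 2) ≤ 1 / 4 := by
    rw [div_le_iff₀ hden]
    nlinarith [pow_nonneg hr.le 3, sq_nonneg (a * z 3), mul_nonneg hM (pow_nonneg hr.le 3)]
  linarith

/-- **Far coercivity of the Kerr–Schild forms.** For `M ≥ 0`, `r > 0` and `r ≥ 4M`: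
`‖v‖/2 ≤ ‖g_{M,a}(z)(v, ·)‖` (operator norm of the covector). Test `g(v, ·)` on the
time-reflected vector `w = v − 2v⁰ ∂₀`: `‖w‖ = ‖v‖`, `η(v, w) = ‖v‖²`, `ℓ(w) = ℓ(v) − 2v⁰`, so
`g(v, w) = ‖v‖² + 2H((ℓ(v) − v⁰)² − (v⁰)²) ≥ (1 − 2H)‖v‖² ≥ ‖v‖²/2` as `0 ≤ 2H ≤ 1/2`.
[folklore; Kerr–Schild 1965, §2 (`g = η + 2Hℓ⊗ℓ`, `ℓ₀ = 1`)] -/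
theorem kerrCoercive_far {M : ℝ} (hM : 0 ≤ M) (a : ℝ) {z : E4}
    (hr : 0 < Kerr.radius a z) (h4 : 4 * M ≤ Kerr.radius a z) (v : E4) :
    1 / 2 * ‖v‖ ≤ ‖Kerr.bilin M a z v‖ := by
  set w : E4 := v - (2 * v 0) • E4.basisVector 0 with hw
  have hH0 : 0 ≤ Kerr.scalarH M a z := Kerr.scalarH_nonneg hM a z
  have hH : 2 * Kerr.scalarH M a z ≤ 1 / 2 := kerrCoercive_two_mul_scalarH_le_half hM a hr h4
  -- `η(v, w) = ‖v‖²`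
  have hη : Minkowski.bilin v w = ‖v‖ ^ 2 := by
    rw [hw, EuclideanSpace.real_norm_sq_eq]
    simp [Fin.sum_univ_four, Fin.sum_univ_three]
    ring
  -- `ℓ(w) = ℓ(v) − 2 v⁰`
  have hℓ : Kerr.nullCovector a z w = Kerr.nullCovector a z v - 2 * v 0 := by
    rw [hw, map_sub, map_smul, Kerr.nullCovector_basisVector_zero, smul_eq_mul, mul_one]
  -- `‖w‖ = ‖v‖`
  have hwn : ‖w‖ = ‖v‖ := by
    have h2 : ‖w‖ ^ 2 = ‖v‖ ^ 2 := by
      rw [hw, EuclideanSpace.real_norm_sq_eq, EuclideanSpace.real_norm_sq_eq]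
      simp [Fin.sum_univ_four]
      ring
    exact (sq_eq_sq₀ (norm_nonneg w) (norm_nonneg v)).mp h2
  -- `(v⁰)² ≤ ‖v‖²`
  have hv0 : v 0 ^ 2 ≤ ‖v‖ ^ 2 := by
    rw [EuclideanSpace.real_norm_sq_eq, Fin.sum_univ_four]
    nlinarith [sq_nonneg (v 1), sq_nonneg (v 2), sq_nonneg (v 3)]
  -- `g(v, w) ≥ ‖v‖²/2`
  have hg : 1 / 2 * ‖v‖ * ‖v‖ ≤ Kerr.bilin M a z v w := by
    rw [Kerr.bilin_apply, hη, hℓ]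
    have h1 := mul_nonneg hH0 (sq_nonneg (Kerr.nullCovector a z v - v 0))
    have h2 := mul_nonneg hH0 (sub_nonneg.2 hv0)
    have h3 := mul_nonneg (sub_nonneg.2 hH) (sq_nonneg ‖v‖)
    nlinarith [h1, h2, h3]
  -- `g(v, w) ≤ ‖g(v, ·)‖ ‖w‖ = ‖g(v, ·)‖ ‖v‖`
  have hle : Kerr.bilin M a z v w ≤ ‖Kerr.bilin M a z v‖ * ‖v‖ := by
    calc Kerr.bilin M a z v w ≤ ‖Kerr.bilin M a z v w‖ := Real.le_norm_self _
      _ ≤ ‖Kerr.bilin M a z v‖ * ‖w‖ := ContinuousLinearMap.le_opNorm _ _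
      _ = ‖Kerr.bilin M a z v‖ * ‖v‖ := by rw [hwn]
  rcases eq_or_ne v 0 with rfl | hv
  · simp
  · exact le_of_mul_le_mul_right (hg.trans hle) (norm_pos_iff.mpr hv)

/-- (W3-A) **Uniform coercivity of the Kerr–Schild forms on the exterior `{r ≥ r_lo}`,
`r_lo > 0`, `M ≥ 0`** (all times, all large radii): there is `β > 0` with
`β‖v‖ ≤ ‖g_{M,a}(z)(v, ·)‖` for all `z` with `r(z) ≥ r_lo` and all `v`. Split at
`R₀ = max r_lo (4M + 1)`: beyond `R₀` the far bound `kerrCoercive_far` (`β = 1/2`), on the band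
`r_lo ≤ r ≤ R₀` the landed band coercivity `stub_injective_mfderiv_of_close.2` (compact time
slice, nondegeneracy `Kerr.bilin_nondegenerate`, stationarity). [folklore; Kerr–Schild 1965, §2] -/
theorem stub_kerrBilin_coercive_exterior :
    ∀ (M a r_lo : ℝ), 0 ≤ M → 0 < r_lo →
      ∃ β : ℝ, 0 < β ∧ ∀ z : E4, r_lo ≤ Kerr.radius a z → ∀ v : E4, β * ‖v‖ ≤ ‖Kerr.bilin M a z v‖ := by
  intro M a r_lo hM hlo
  set R₀ : ℝ := max r_lo (4 * M + 1)
  obtain ⟨β₁, hβ₁, hband⟩ :=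
    stub_injective_mfderiv_of_close.2 M a r_lo R₀ hlo (le_max_left _ _)
  refine ⟨min (1 / 2) β₁, lt_min one_half_pos hβ₁, fun z hz v ↦ ?_⟩
  rcases le_total R₀ (Kerr.radius a z) with hfar | hnear
  · have hr : 0 < Kerr.radius a z := hlo.trans_le hz
    have h4 : 4 * M ≤ Kerr.radius a z := by
      have : 4 * M + 1 ≤ Kerr.radius a z := (le_max_right _ _).trans hfar
      linarith
    calc min (1 / 2) β₁ * ‖v‖ ≤ 1 / 2 * ‖v‖ :=
          mul_le_mul_of_nonneg_right (min_le_left _ _) (norm_nonneg _)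
      _ ≤ ‖Kerr.bilin M a z v‖ := kerrCoercive_far hM a hr h4 v
  · calc min (1 / 2) β₁ * ‖v‖ ≤ β₁ * ‖v‖ :=
          mul_le_mul_of_nonneg_right (min_le_right _ _) (norm_nonneg _)
      _ ≤ ‖Kerr.bilin M a z v‖ := hband z hz hnear v

end Summit.FinalStateConjecture.FinalStateConjecture.Theorems

end
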